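import Summits.HodgeConjecture.HodgeConjecture.Theorems.Ring2HypothesesDescent
import Literature.AlgebraicGeometry.HodgeTheory.MotivatedClassesRationalSpan
import HarnessLib

/-!
# Ring 2 — hypotheses layer, part XXXIV: the descent axis acquires its cross edge
# `AbsoluteHodgeImpliesAlgebraic ⟹ MotivatedImpliesAlgebraic` (André Prop. 2.5.1 with Prop. 3.2.1)

HONEST FRAMING (page 1, unchanged): research route conditional on HC_CM; not a corollary; Q11.4-sentence-2
already refuted in dim ≥ 3. `HC_CM` is the binder `Theses.RankFourFaces.CMAbelianHodge`, referred to BY NAME,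
always an ARGUMENT, never a fact. Nothing in this file asserts `HC_CM`, `HC_AV`, `HodgeConjecture` or any
descent node; every theorem is an implication between NAMED hypotheses of the axis.

WHAT. Part III (`Ring2HypothesesDescent`) typed the two descent readings of the missing step — §A "absolute
Hodge ⟹ algebraic" (`AbsoluteHodgeImpliesAlgebraic[AV|Qbar]`, Deligne 1982) and §B "motivated ⟹ algebraic"
(`MotivatedImpliesAlgebraic[AV]`, André 1996) — as two PARALLEL columns, joined only through `HC_AV` on
abelian varieties (Deligne's Main Thm. 2.11 on one side, André's Thm. 0.6.2 on the other). The bookkeeping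
implication BETWEEN the columns that the published theorems give was missing:

  rational motivated classes are absolute Hodge (André 1996, Prop. 2.5.1 — the tree's refereed named fact
  `Andre1996_isAbsoluteHodgeClass_of_mem_motivatedClasses`, binder `hAH` below, never asserted), so
  "absolute Hodge ⟹ algebraic" should give "motivated ⟹ algebraic".

On the real carriers this needs one more published input, because Prop. 2.5.1 speaks of RATIONAL motivated
classes while the node `MotivatedImpliesAlgebraic` bounds the whole `ℂ`-span `motivatedClasses n X p =
A_motᵖ(X)_ℂ`: André's Prop. 3.2.1 with Prop. 3.3 (`A_mot(X)_ℚ ⊗ ℂ → A_mot(X)_ℂ` is onto; `Q = ℚ` for Betti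
cohomology). That input is now a TREE THEOREM,
`Literature.AlgebraicGeometry.HodgeTheory.motivatedClasses_le_span_isRationalClass`
(`Literature/AlgebraicGeometry/HodgeTheory/MotivatedClassesRationalSpan.lean`: `A_motᵖ(X)_ℂ` is the `ℂ`-span
of its rational generators, proved on the generators of Déf. 1), with the operational form
`motivatedClasses_le_of_isAbsoluteHodgeClass (hAH)`. This file feeds it:

* §A RATIONAL FORMS, fact-free: `motivatedImpliesAlgebraic_iff_rational`,
  `motivatedImpliesAlgebraicAV_iff_rational` — the motivated nodes are equivalent to their restrictions to
  RATIONAL classes (the form in which every published input about `A_mot(X)_ℚ` is stated).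
* §B THE CROSS EDGES, modulo the ONE refereed fact [hAH] (André Prop. 2.5.1):
  `motivatedImpliesAlgebraic_of_absoluteHodgeImpliesAlgebraic : [hAH] → AbsoluteHodgeImpliesAlgebraic →
  MotivatedImpliesAlgebraic` (all smooth projective varieties — NEW: before this part the axis had no
  derivation of the all-varieties motivated node from the absolute-Hodge one),
  `motivatedImpliesAlgebraicAV_of_absoluteHodgeImpliesAlgebraicAV` (abelian varieties; before: only through
  `HC_AV`, i.e. modulo [hAM, hAH] via André-gives-Deligne, or modulo [Deligne]),
  `motivatedImpliesAlgebraic_of_voisin_of_absoluteHodgeImpliesAlgebraicQbar` (the `ℚ̄` node, with Voisin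
  2007 Prop. 1.2, refereed fact `voisin2007_hodgeConjecture_absolute_of_qbar`, binder `hV`).
* §C CONSEQUENCES on abelian varieties WITHOUT Deligne's theorem as an input: granted André's two facts
  [hAM] (Thm. 0.6.2, Hodge ⟹ motivated on abelian varieties) and [hAH],
  `AbsoluteHodgeImpliesAlgebraicAV ⟺ MotivatedImpliesAlgebraicAV ⟺ HC_AV`, and `HC_CM` is again a
  CONSEQUENCE on this row (`hc_cm_of_andre_of_absoluteHodgeImpliesAlgebraicAV`), never an input.
* §D THE HASSE DIAGRAM of the descent axis after this part, as one ledger theorem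
  (`descent_hasse_of_andre`): `HodgeConjecture ⟹ AbsoluteHodgeImpliesAlgebraic ⟹[hAH] MotivatedImpliesAlgebraic
  ⟹ MotivatedImpliesAlgebraicAV ⟹[hAM] HC_AV ⟹ HC_CM`, and `AbsoluteHodgeImpliesAlgebraic ⟹
  AbsoluteHodgeImpliesAlgebraicAV ⟹[hAH] MotivatedImpliesAlgebraicAV`.

Consumption status for the hypotheses-axis census: node `MotivatedImpliesAlgebraic` gains the incoming edge
from `AbsoluteHodgeImpliesAlgebraic` modulo [hAH]; node `MotivatedImpliesAlgebraicAV` gains the incoming edge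
from `AbsoluteHodgeImpliesAlgebraicAV` modulo [hAH] (was: modulo [Deligne] or [hAM, hAH]); no node is added,
no node changes strength; `HC_CM` stays off-path on the whole axis (part III §B docstring).

Which hypotheses survive the Q11.4 no-go: all of them — the descent nodes concern algebraicity of absolute
Hodge / motivated classes and are implied by the Hodge conjecture (ON-PATH, part III); Markman's refuted
sentence (secant sheaves, dim ≥ 3) is not among their inputs.

Sources: [cite: Andre1996Motifs, Prop. 2.5.1 (p. 18), Prop. 3.2.1 (p. 20), Prop. 3.3 (p. 21), Thm. 0.6.2
(p. 9), §6.3 Remarque 2 (p. 33)] [cite: Deligne1982HodgeCycles, Main Thm. 2.11 (p. 19)]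
[cite: Voisin2007HodgeLoci, Prop. 1.2 and Rem. 1.4]. No `sorry`, no new axiom, no new named fact; every
theorem is a short instantiation of part III and of the Literature theorem. -/

-- The summit's namespace repeats `HodgeConjecture` (summit = sub-problem); every file of the axis disables this linter.
set_option linter.dupNamespace false

namespace Summit.HodgeConjecture.HodgeConjecture.Ring2.Hypotheses

open Literature.AlgebraicGeometry Literature.AlgebraicGeometry.Motives
open Literature.AlgebraicGeometry.HodgeTheory

/-! ## §A Rational forms of the motivated nodes (André Prop. 3.2.1, theorem-fed) -/

/-- **`MotivatedImpliesAlgebraic` is equivalent to its restriction to RATIONAL motivated classes**: to put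
`A_motᵖ(X)_ℂ` inside `Nᵖ H²ᵖ(X(ℂ); ℂ)` it suffices to put its rational classes there, since `A_motᵖ(X)_ℂ` is
the `ℂ`-span of its rational generators (André Prop. 3.2.1 with Prop. 3.3, tree theorem
`motivatedClasses_le_of_forall_isRationalClass_mem`). Fact-free.
[cite: Andre1996Motifs, Prop. 3.2.1 (p. 20) and Prop. 3.3 (p. 21)] -/
theorem motivatedImpliesAlgebraic_iff_rational :
    MotivatedImpliesAlgebraic ↔
      ∀ ⦃n : ℕ⦄ ⦃X : SchemeOver ℂ⦄, IsSmoothProjective n X → ∀ (p : ℕ) (c : complexBetti X (2 * p)),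
        IsRationalClass c → c ∈ motivatedClasses n X p → c ∈ algebraicClasses X p :=
  ⟨fun h _ _ hX p _ _ hc => h hX p hc,
    fun h _ _ hX p => motivatedClasses_le_of_forall_isRationalClass_mem hX fun c hc hcQ => h hX p c hcQ hc⟩

/-- The same on abelian varieties: **`MotivatedImpliesAlgebraicAV` ⟺ every RATIONAL motivated class on every
complex abelian variety is algebraic**. Fact-free. [cite: Andre1996Motifs, Prop. 3.2.1 (p. 20) and Prop. 3.3 (p. 21)] -/
theorem motivatedImpliesAlgebraicAV_iff_rational :
    MotivatedImpliesAlgebraicAV ↔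
      ∀ (A : AbelianVariety ℂ) (p : ℕ) (c : complexBetti A.X (2 * p)),
        IsRationalClass c → c ∈ motivatedClasses A.dim A.X p → c ∈ algebraicClasses A.X p :=
  ⟨fun h A p _ _ hc => h A p hc,
    fun h A p => motivatedClasses_le_of_forall_isRationalClass_mem
      (AbelianVariety.isSmoothProjective_holds (A := A)) fun c hc hcQ => h A p c hcQ hc⟩

/-! ## §B The cross edges: absolute Hodge ⟹ motivated, modulo André Prop. 2.5.1 -/

/-- **`[hAH] ∧ AbsoluteHodgeImpliesAlgebraic ⟹ MotivatedImpliesAlgebraic`** — the cross edge of the descent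
axis on ALL smooth projective complex varieties: a rational motivated class is absolute Hodge (André
Prop. 2.5.1, refereed named fact `Andre1996_isAbsoluteHodgeClass_of_mem_motivatedClasses`, the binder `hAH`,
not asserted), hence algebraic by the hypothesis, and the rational motivated classes span `A_motᵖ(X)_ℂ`
(Prop. 3.2.1, tree theorem). [cite: Andre1996Motifs, Prop. 2.5.1 (p. 18) and Prop. 3.2.1 (p. 20)]
[cite: Deligne1982HodgeCycles, Def. 2.10] -/
theorem motivatedImpliesAlgebraic_of_absoluteHodgeImpliesAlgebraic
    (hAH : Andre1996_isAbsoluteHodgeClass_of_mem_motivatedClasses) (h : AbsoluteHodgeImpliesAlgebraic) :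
    MotivatedImpliesAlgebraic :=
  fun _ _ hX p => motivatedClasses_le_of_isAbsoluteHodgeClass hAH hX fun c _ hc => h hX p c hc

/-- **`[hAH] ∧ AbsoluteHodgeImpliesAlgebraicAV ⟹ MotivatedImpliesAlgebraicAV`** — the cross edge on abelian
varieties, modulo André Prop. 2.5.1 ONLY (neither Deligne's Main Thm. 2.11 nor André's Thm. 0.6.2 is used;
compare the detour through `HC_AV` of parts III/XXV). [cite: Andre1996Motifs, Prop. 2.5.1 (p. 18) and Prop. 3.2.1 (p. 20)] -/
theorem motivatedImpliesAlgebraicAV_of_absoluteHodgeImpliesAlgebraicAV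
    (hAH : Andre1996_isAbsoluteHodgeClass_of_mem_motivatedClasses) (h : AbsoluteHodgeImpliesAlgebraicAV) :
    MotivatedImpliesAlgebraicAV :=
  fun A p => motivatedClasses_le_of_isAbsoluteHodgeClass hAH
    (AbelianVariety.isSmoothProjective_holds (A := A)) fun c _ hc => h A p c hc

/-- **`[Voisin] ∧ [hAH] ∧ AbsoluteHodgeImpliesAlgebraicQbar ⟹ MotivatedImpliesAlgebraic`**: the `ℚ̄` node of
the absolute-Hodge column also reaches the motivated column (Voisin 2007 Prop. 1.2, refereed fact
`voisin2007_hodgeConjecture_absolute_of_qbar`, binder `hV`; then the cross edge).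
[cite: Voisin2007HodgeLoci, Prop. 1.2 and Rem. 1.4] [cite: Andre1996Motifs, Prop. 2.5.1 (p. 18) and Prop. 3.2.1 (p. 20)] -/
theorem motivatedImpliesAlgebraic_of_voisin_of_absoluteHodgeImpliesAlgebraicQbar
    (hV : voisin2007_hodgeConjecture_absolute_of_qbar)
    (hAH : Andre1996_isAbsoluteHodgeClass_of_mem_motivatedClasses) (h : AbsoluteHodgeImpliesAlgebraicQbar) :
    MotivatedImpliesAlgebraic :=
  motivatedImpliesAlgebraic_of_absoluteHodgeImpliesAlgebraic hAH (absoluteHodgeImpliesAlgebraic_of_qbar_of_voisin hV h)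

/-! ## §C Abelian varieties: the two columns and `HC_AV` coincide granted André's two facts (no Deligne) -/

/-- **`[hAM] ∧ [hAH] ⟹ (AbsoluteHodgeImpliesAlgebraicAV ⟺ MotivatedImpliesAlgebraicAV)`**: `⟹` is the cross
edge (Prop. 2.5.1 + 3.2.1); `⟸` goes through `HC_AV` by André's Thm. 0.6.2 (`hAM`, Hodge classes on abelian
varieties are motivated; part III `hc_av_of_andre_of_motivatedImpliesAlgebraicAV`) and the on-path edge
`absoluteHodgeImpliesAlgebraicAV_of_hc_av`. Deligne's theorem is not an input (it is itself a consequence of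
[hAM] ∧ [hAH], André p. 9, tree theorem `deligne1982_hodgeClasses_abelianVariety_absoluteHodge_of_andre1996`).
[cite: Andre1996Motifs, Thm. 0.6.2 (p. 9), Prop. 2.5.1 (p. 18) and Prop. 3.2.1 (p. 20)] -/
theorem absoluteHodgeImpliesAlgebraicAV_iff_motivatedImpliesAlgebraicAV_of_andre
    (hAM : Andre1996_hodgeClasses_abelianVariety_motivated)
    (hAH : Andre1996_isAbsoluteHodgeClass_of_mem_motivatedClasses) :
    AbsoluteHodgeImpliesAlgebraicAV ↔ MotivatedImpliesAlgebraicAV :=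
  ⟨motivatedImpliesAlgebraicAV_of_absoluteHodgeImpliesAlgebraicAV hAH,
    fun h => absoluteHodgeImpliesAlgebraicAV_of_hc_av (hc_av_of_andre_of_motivatedImpliesAlgebraicAV hAM h)⟩

/-- **`[hAM] ∧ [hAH] ∧ AbsoluteHodgeImpliesAlgebraicAV ⟹ HC_AV`**, André's two facts in place of Deligne's
theorem (part III `hc_av_of_deligne_of_absoluteHodgeImpliesAlgebraicAV` took Deligne as the input): the cross
edge, then Thm. 0.6.2 (§6.3 Remarque 2, p. 33: "Ce théorème ramène en particulier la conjecture de Hodge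
pour les variétés abéliennes à la question de savoir si l'involution de Lefschetz … est donnée par une
correspondance algébrique"). [cite: Andre1996Motifs, Thm. 0.6.2 (p. 9), §6.3 Remarque 2 (p. 33) and Prop. 2.5.1 (p. 18)] -/
theorem hc_av_of_andre_of_absoluteHodgeImpliesAlgebraicAV
    (hAM : Andre1996_hodgeClasses_abelianVariety_motivated)
    (hAH : Andre1996_isAbsoluteHodgeClass_of_mem_motivatedClasses) (h : AbsoluteHodgeImpliesAlgebraicAV) :
    Theses.PadicSemiregularLift.HodgeAbelianVarieties :=
  hc_av_of_andre_of_motivatedImpliesAlgebraicAV hAM (motivatedImpliesAlgebraicAV_of_absoluteHodgeImpliesAlgebraicAV hAH h)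

/-- … hence **`[hAM] ∧ [hAH] ∧ AbsoluteHodgeImpliesAlgebraicAV ⟹ HC_CM`**: on this row too `HC_CM` is a
CONSEQUENCE modulo the two refereed facts, never an input. [cite: Andre1996Motifs, Thm. 0.6.2 (p. 9) and Prop. 2.5.1 (p. 18)] -/
theorem hc_cm_of_andre_of_absoluteHodgeImpliesAlgebraicAV
    (hAM : Andre1996_hodgeClasses_abelianVariety_motivated)
    (hAH : Andre1996_isAbsoluteHodgeClass_of_mem_motivatedClasses) (h : AbsoluteHodgeImpliesAlgebraicAV) :
    Theses.RankFourFaces.CMAbelianHodge :=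
  Ring2.Deform.HC_CM_of_HC_AV (hc_av_of_andre_of_absoluteHodgeImpliesAlgebraicAV hAM hAH h)

/-! ## §D The Hasse diagram of the descent axis after part XXXIV -/

/-- **LEDGER THEOREM — the descent axis as one chain**, granted the two refereed André facts [hAH]
(Prop. 2.5.1) and [hAM] (Thm. 0.6.2), both hypotheses: `HodgeConjecture ⟹ AbsoluteHodgeImpliesAlgebraic
⟹ MotivatedImpliesAlgebraic ⟹ MotivatedImpliesAlgebraicAV ⟹ HC_AV ⟹ HC_CM`, together with the abelian
branch `AbsoluteHodgeImpliesAlgebraic ⟹ AbsoluteHodgeImpliesAlgebraicAV ⟹ MotivatedImpliesAlgebraicAV`. Every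
arrow is a theorem of parts III / XXXIV; nothing in the chain is asserted.
[cite: Andre1996Motifs, Prop. 2.5.1 (p. 18), Prop. 3.2.1 (p. 20) and Thm. 0.6.2 (p. 9)]
[cite: Deligne1982HodgeCycles, Def. 2.10] -/
theorem descent_hasse_of_andre
    (hAH : Andre1996_isAbsoluteHodgeClass_of_mem_motivatedClasses)
    (hAM : Andre1996_hodgeClasses_abelianVariety_motivated) :
    (_root_.HodgeConjecture → AbsoluteHodgeImpliesAlgebraic) ∧
    (AbsoluteHodgeImpliesAlgebraic → MotivatedImpliesAlgebraic) ∧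
    (MotivatedImpliesAlgebraic → MotivatedImpliesAlgebraicAV) ∧
    (MotivatedImpliesAlgebraicAV → Theses.PadicSemiregularLift.HodgeAbelianVarieties) ∧
    (Theses.PadicSemiregularLift.HodgeAbelianVarieties → Theses.RankFourFaces.CMAbelianHodge) ∧
    (AbsoluteHodgeImpliesAlgebraic → AbsoluteHodgeImpliesAlgebraicAV) ∧
    (AbsoluteHodgeImpliesAlgebraicAV → MotivatedImpliesAlgebraicAV) :=
  ⟨absoluteHodgeImpliesAlgebraic_of_hodgeConjecture,
    motivatedImpliesAlgebraic_of_absoluteHodgeImpliesAlgebraic hAH,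
    motivatedImpliesAlgebraicAV_of_all,
    hc_av_of_andre_of_motivatedImpliesAlgebraicAV hAM,
    Ring2.Deform.HC_CM_of_HC_AV,
    absoluteHodgeImpliesAlgebraicAV_of_all,
    motivatedImpliesAlgebraicAV_of_absoluteHodgeImpliesAlgebraicAV hAH⟩

end Summit.HodgeConjecture.HodgeConjecture.Ring2.Hypotheses
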